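import Summits.AtomisticToContinuum.Crystallization.Theorems.FrustratedLawDichotomyTextureUniformVerdict

/-!
# FrustratedLawDichotomy · crux `AperiodicFrustratedLawGap` (stmt-AtomisticToContinuum-27623) — the `Gy` / `TexBall` API (monotonicity in the tolerance, clause accessors)
# (decomp-a2c hand-2 g45, STRUCTURAL share #61: DEF-FREE; small by-name API over the NAMED `Gy`/`TexBall` of `…RepetitiveNetworkReductionRecurrentMemberDefs`)

The crux's goodness predicate `Gy η N y j` («site `j` has an `η`-good fcc/hcp first shell») and the texture predicate `TexBall` are used at two
tolerances (`1/20` and `1/8`) and through five clauses; every consumer so far re-destructures the verbatim `let`-bodies.  This file gives the obvious API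
BY NAME, with NO new definitions:

* `gy_mono` — `Gy η → Gy η'` for `η ≤ η'` (same isometry, same labelling); `gy_eighth_of_gy_twentieth` (`1/20`-good ⇒ `1/8`-good) and its contrapositive
  `not_gy_twentieth_of_not_gy_eighth` (`1/8`-bad ⇒ `1/20`-bad);
* `TexBall` clause accessors: `texBall_sep` (clause 1, `7/10`-separation), `texBall_allBad` (clause 2: every site of the `R`-ball is `1/20`-bad),
  `texBall_noSolidBall` (clause 3), `texBall_goodNear` (clause 4: a `1/8`-good site within `R₈` of every ball site), `texBall_noCoarse` (clause 5);
* `texBall_centre_bad` (the centre itself is `1/20`-bad, `0 ≤ R`) and `texBall_exists_good_and_bad` (the ball contains a `1/8`-good site within `R₈` of the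
  centre AND the `1/20`-bad centre — the two tolerances never give a uniform picture).

Tags: [folklore: logic].
-/

noncomputable section

namespace Summit.AtomisticToContinuum.Crystallization.Theorems.FrustratedLawDichotomyTextureGoodnessAPI

open Summit.AtomisticToContinuum.Crystallization.Theorems.RepetitiveNetworkReductionRecurrentMember (Gy TexBall)

variable {N : ℕ} {y : Fin N → EuclideanSpace ℝ (Fin 3)} {i j : Fin N} {R R₇ R₈ R₉ η η' : ℝ}

/-! ## `Gy` is monotone in the tolerance -/

/-- **Monotonicity of goodness in the tolerance**: an `η`-good first shell is `η'`-good for every `η' ≥ η` (same isometry, same labelling). [folklore] -/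
theorem gy_mono (h : Gy η N y j) (hle : η ≤ η') : Gy η' N y j := by
  dsimp only [Gy] at h ⊢
  obtain ⟨A, hA⟩ := h
  refine ⟨A, ?_⟩
  rcases hA with ⟨e, he⟩ | ⟨e, he⟩
  · exact Or.inl ⟨e, fun t => (he t).trans hle⟩
  · exact Or.inr ⟨e, fun t => (he t).trans hle⟩

/-- `1/20`-good ⇒ `1/8`-good. [folklore] -/
theorem gy_eighth_of_gy_twentieth (h : Gy (1 / 20) N y j) : Gy (1 / 8) N y j :=
  gy_mono h (by norm_num)

/-- `1/8`-bad ⇒ `1/20`-bad. [folklore] -/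
theorem not_gy_twentieth_of_not_gy_eighth (h : ¬ Gy (1 / 8) N y j) : ¬ Gy (1 / 20) N y j :=
  fun h' => h (gy_eighth_of_gy_twentieth h')

/-! ## `TexBall` clause accessors -/

/-- Clause 1: the configuration is `7/10`-separated. [folklore] -/
theorem texBall_sep (h : TexBall N y i R R₇ R₈ R₉) : ∀ a b : Fin N, a ≠ b → (7 : ℝ) / 10 ≤ dist (y a) (y b) := h.1

/-- Clause 2: every site of the `R`-ball about the centre is `1/20`-BAD. [folklore] -/
theorem texBall_allBad (h : TexBall N y i R R₇ R₈ R₉) : ∀ j : Fin N, dist (y j) (y i) ≤ R → ¬ Gy (1 / 20) N y j := h.2.1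

/-- Clause 3: no site of the `R`-ball is the centre of an all-`1/20`-bad, `1`-covered, `5`-ring-coordinated `R₇`-ball (¬𝔚). [folklore] -/
theorem texBall_noSolidBall (h : TexBall N y i R R₇ R₈ R₉) : ∀ j : Fin N, dist (y j) (y i) ≤ R →
    ¬ ((∀ j' : Fin N, dist (y j') (y j) ≤ R₇ → ¬ Gy (1 / 20) N y j') ∧
      (∀ z : EuclideanSpace ℝ (Fin 3), dist z (y j) ≤ R₇ → ∃ k : Fin N, dist z (y k) ≤ 1) ∧
      (∀ j' : Fin N, dist (y j') (y j) ≤ R₇ → (let d : ℝ := sInf ((fun z => dist z (y j')) '' (Set.range y \ {y j'}));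
        ∀ k : Fin N, y k ≠ y j' → dist (y k) (y j') < 27 / 20 * d →
          5 ≤ Nat.card {m : Fin N // y m ≠ y j' ∧ dist (y m) (y j') < 27 / 20 * d ∧ y m ≠ y k ∧ dist (y m) (y k) < 27 / 20 * d}))) :=
  h.2.2.1

/-- Clause 4: every site of the `R`-ball has a `1/8`-GOOD site within `R₈`. [folklore] -/
theorem texBall_goodNear (h : TexBall N y i R R₇ R₈ R₉) :
    ∀ j : Fin N, dist (y j) (y i) ≤ R → ∃ k : Fin N, dist (y k) (y j) ≤ R₈ ∧ Gy (1 / 8) N y k := h.2.2.2.1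

/-- Clause 5: no site of the `R`-ball is the centre of an all-`1/20`-bad `R₉`-ball with at most half `1/8`-bad sites and no `5`-ring obstruction at the
`1/8`-bad ones (¬𝔓). [folklore] -/
theorem texBall_noCoarse (h : TexBall N y i R R₇ R₈ R₉) : ∀ j : Fin N, dist (y j) (y i) ≤ R →
    ¬ ((∀ j' : Fin N, dist (y j') (y j) ≤ R₉ → ¬ Gy (1 / 20) N y j') ∧
      (Nat.card {j' : Fin N // dist (y j') (y j) ≤ R₉ ∧ ¬ Gy (1 / 8) N y j'} : ℝ) ≤
        1 / 2 * (Nat.card {j' : Fin N // dist (y j') (y j) ≤ R₉} : ℝ) ∧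
      (∀ j' : Fin N, dist (y j') (y j) ≤ R₉ → ¬ Gy (1 / 8) N y j' →
        ¬ (let d : ℝ := sInf ((fun z => dist z (y j')) '' (Set.range y \ {y j'}));
          ∀ k : Fin N, y k ≠ y j' → dist (y k) (y j') < 27 / 20 * d →
            5 ≤ Nat.card {m : Fin N // y m ≠ y j' ∧ dist (y m) (y j') < 27 / 20 * d ∧ y m ≠ y k ∧ dist (y m) (y k) < 27 / 20 * d}))) :=
  h.2.2.2.2

/-! ## Two immediate consequences -/

/-- **The centre is `1/20`-bad** (clause 2 at the centre, `0 ≤ R`). [folklore] -/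
theorem texBall_centre_bad (h : TexBall N y i R R₇ R₈ R₉) (hR : 0 ≤ R) : ¬ Gy (1 / 20) N y i :=
  texBall_allBad h i (by rw [dist_self]; exact hR)

/-- **Both tolerances are seen in every textured ball**: a `1/8`-good site within `R₈` of the centre and the `1/20`-bad centre (`0 ≤ R`). [folklore] -/
theorem texBall_exists_good_and_bad (h : TexBall N y i R R₇ R₈ R₉) (hR : 0 ≤ R) :
    (∃ k : Fin N, dist (y k) (y i) ≤ R₈ ∧ Gy (1 / 8) N y k) ∧ ¬ Gy (1 / 20) N y i :=
  ⟨texBall_goodNear h i (by rw [dist_self]; exact hR), texBall_centre_bad h hR⟩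

end Summit.AtomisticToContinuum.Crystallization.Theorems.FrustratedLawDichotomyTextureGoodnessAPI

end
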